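import Summits.ABC.StewartYu.PadicG3CountR
import Summits.ABC.StewartYu.PadicG3SchedS2
import Summits.ABC.StewartYu.PadicG3SchedB
import HarnessLib

/-!
# Cell abc-stewartyu, crux `Y07Odd` (stmt-ABC-19658): the hB1 conjunct of `IneqPackR₂` (box `sideS₂ = ⌊Lbox/(2Aⱼ)⌋`,
# R21-d) at p2's schedules `schedV`, `sched1` and the free-box-scale schedules `schedVb 1`, `sched1b 1` — LITERALLY

`Summits/ABC/StewartYu/PadicG3CountRb.lean` — cell `abc-stewartyu` (HOME `run/shared/lean/pub/abc-stewartyu/`),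
route `PadicPrimesKummerThird`, crux `Y07Odd` (stmt-ABC-19658); seat lp-1 (g3).  Theorems only.

p2's re-registrations of 2026-08-27T05:24Z/05:31Z state the START count as the first conjunct of
`IneqPackR₂ S Sc` — `2·#(Icc(−NS Sc 0 0, NS Sc 0 0) ×ˢ tauSetR n j₀ (TordS Sc 0 0))·((p−1)·p^{Sc.m}) ≤
(Sc.L₀+1)·∏(2·sideS₂ Sc j+1)` with `sideS₂ Sc j = ⌊Sc.Lbox/(2·Sc.A j)⌋` (`PadicG3SchedS2`, p499649) — at
`Sc := P.schedVb b` / `P.sched1b b` (`PadicG3SchedB`, p501127: `Lbox := LV/b` resp. `L/b`).  p1's Siegel counts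
(`siegel_countV'`, v1 `siegel_count₁`) certify the PRINT box `b = 1` (half-width `L/(2Aⱼ)`); here that conjunct is
delivered verbatim at `schedV`, `sched1`, `schedVb 1`, `sched1b 1` (`sideS₂ = sideV`/`side` by `rfl`/`div_one`), from
`startCountRV_sched` / `startCountR1_sched` (`PadicG3CountR`, p499476).  For `b > 1` the unknowns side SHRINKS by
`≈ bⁿ`; no count for it is claimed here.

References: Yu. V. Nesterenko, LNM 1819 (2003), Prop. 3.9 (3.48).
-/

noncomputable section

open Finset
open Literature.NumberTheory.Transcendental

namespace Summit.ABC.StewartYu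

namespace G3Setup

variable {p : ℕ} [Fact p.Prime] (S : G3Setup p) (P : PadicG3Par S.n)

/-- `sideS₂ schedV = sideV`. [folklore] -/
theorem sideS₂_schedV (j : Fin S.n) : S.sideS₂ P.schedV j = P.sideV j := rfl

/-- `sideS₂ sched1 = side`. [folklore] -/
theorem sideS₂_sched1 (j : Fin S.n) : S.sideS₂ P.sched1 j = P.side j := rfl

/-- `sideS₂ (schedVb 1) = sideV`. [folklore] -/
theorem sideS₂_schedVb_one (j : Fin S.n) : S.sideS₂ (P.schedVb 1) j = P.sideV j := by
  unfold sideS₂ PadicG3Par.sideV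
  rw [P.schedVb_Lbox, P.schedVb_A, div_one]

/-- `sideS₂ (sched1b 1) = side`. [folklore] -/
theorem sideS₂_sched1b_one (j : Fin S.n) : S.sideS₂ (P.sched1b 1) j = P.side j := by
  unfold sideS₂ PadicG3Par.side
  rw [P.sched1b_Lbox, P.sched1b_A, div_one]

/-- **hB1 of `IneqPackR₂` at `schedV`** (m = 0; CTX facts `P.p = p`, `P.K₀ = p − 1`). [cite: Nesterenko2003, Prop 3.9 (3.48)] -/
theorem startCountR₂_schedV (hPp : P.p = p) (hK₀ : P.K₀ = p - 1) :
    2 * (Icc (-(S.NS P.schedV 0 0 : ℤ)) (S.NS P.schedV 0 0) ×ˢ tauSetR S.n S.j₀ (S.TordS P.schedV 0 0)).card *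
        ((p - 1) * p ^ P.schedV.m) ≤ (P.schedV.L₀ + 1) * ∏ j, (2 * S.sideS₂ P.schedV j + 1) :=
  S.startCountRV_schedV P hPp hK₀

/-- **hB1 of `IneqPackR₂` at `sched1`** (any m). [cite: Nesterenko2003, Prop 3.9 (3.48)] -/
theorem startCountR₂_sched1 (hPp : P.p = p) (hK₀ : P.K₀ = p - 1) :
    2 * (Icc (-(S.NS P.sched1 0 0 : ℤ)) (S.NS P.sched1 0 0) ×ˢ tauSetR S.n S.j₀ (S.TordS P.sched1 0 0)).card *
        ((p - 1) * p ^ P.sched1.m) ≤ (P.sched1.L₀ + 1) * ∏ j, (2 * S.sideS₂ P.sched1 j + 1) :=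
  S.startCountR1_sched1 P hPp hK₀

/-- **hB1 of `IneqPackR₂` at `schedVb 1`** (the print box, m = 0). [cite: Nesterenko2003, Prop 3.9 (3.48)] -/
theorem startCountR₂_schedVb_one (hPp : P.p = p) (hK₀ : P.K₀ = p - 1) :
    2 * (Icc (-(S.NS (P.schedVb 1) 0 0 : ℤ)) (S.NS (P.schedVb 1) 0 0) ×ˢ
        tauSetR S.n S.j₀ (S.TordS (P.schedVb 1) 0 0)).card * ((p - 1) * p ^ (P.schedVb 1).m) ≤
      ((P.schedVb 1).L₀ + 1) * ∏ j, (2 * S.sideS₂ (P.schedVb 1) j + 1) := by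
  simp only [sideS₂_schedVb_one]
  exact S.startCountRV_sched P (P.schedVb 1) hPp hK₀ rfl le_rfl le_rfl le_rfl

/-- **hB1 of `IneqPackR₂` at `sched1b 1`** (the print box, any m). [cite: Nesterenko2003, Prop 3.9 (3.48)] -/
theorem startCountR₂_sched1b_one (hPp : P.p = p) (hK₀ : P.K₀ = p - 1) :
    2 * (Icc (-(S.NS (P.sched1b 1) 0 0 : ℤ)) (S.NS (P.sched1b 1) 0 0) ×ˢ
        tauSetR S.n S.j₀ (S.TordS (P.sched1b 1) 0 0)).card * ((p - 1) * p ^ (P.sched1b 1).m) ≤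
      ((P.sched1b 1).L₀ + 1) * ∏ j, (2 * S.sideS₂ (P.sched1b 1) j + 1) := by
  simp only [sideS₂_sched1b_one]
  exact S.startCountR1_sched P (P.sched1b 1) hPp hK₀ rfl P.Xs_zero_le_X le_rfl le_rfl

end G3Setup

end Summit.ABC.StewartYu

end
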